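import Mathlib
import HarnessLib
import Summits.Ventures.LatticeQCDFlow.Exactness.CoordinateTransitive

/-!
# The uniform law of a coordinate sub-sphere of `S^{2N−1}` and the orbit laws of the coordinate subgroups of `SU(N)`

HONEST FRAMING: exact (Metropolis-corrected) sampling algorithms for lattice gauge theory;
figures of merit are autocorrelation/cost numbers at stated couplings and volumes; no
continuum-physics claim.

Venture `LatticeQCDFlow` (cell pub-lqcd), topic `Exactness`, FANOUT row 9 (eng-latcore, the
engine `latflow.core`).  NEW WORK of the cell over Mathlib (`stdGaussian`, `stdGaussian_map`,
`map_pi_eq_stdGaussian`, Tonelli) and row 9's `RadialPolar.lean` / `StdGaussianRadial.lean`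
(`dirSphere`, `uniformSphere`, `stdGaussian_map_dirSphere`), `ComplexSphereAction.lean`,
`CoordinateSubgroups.lean`, `CoordinateTransitive.lean`; nothing is cited as a fact.  Printed
counterpart, NAMED ONLY: uniqueness of the `U(k)`-invariant probability on `S^{2k−1}` (Folland,
*Real Analysis* 2.49 ff.).  This generalises row 9's `SphereOrbitLaw.lean` (`SO(d)` on `S^{d−1}`)
to the complex coordinate subgroups `SU(s) ⊆ SU(N)` needed by the Cabibbo–Marinari ergodicity
proof (the induction over coordinate subgroups compares convolutions of SU(2)-pair Haar measures
with these sub-sphere laws).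

## What is proved (`n` finite nonempty, `E n = ℝ^{n ⊕ n}`, `S n` its unit sphere, `s : Finset n`)

* §1 `projE s` (projection onto the coordinates in `s`, `cplx_projE`), **`subLaw s`** — the law of
  the direction of a standard Gaussian vector projected onto `ℂ^s`: the uniform probability of the
  sub-sphere `S(ℂ^s) ⊆ S^{2N−1}`; `subLaw_univ` (= `uniformSphere volume`);
  `stdGaussian_projE_eq_zero` (the projection vanishes on a null set, `s ≠ ∅`);
  **`ae_subLaw_supported`** (it is carried by the sub-sphere).
* §2 `coe_dirSphere_linearIsometryEquiv` / `dirSphere_rotC` (equivariance of the direction map);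
  `rotC_projE` (elements of `coordSubgroup s` commute with `projE s`); `stdGaussian_map_rotC`;
  **`subLaw_map_actSU`** — `subLaw s` is invariant under `coordSubgroup s`.
* §3 **`map_orbMap_eq_subLaw`** — for a probability law `μ` on `SU(N)` carried by
  `coordSubgroup s` and right-invariant under enough of its elements to reach every point of the
  sub-sphere from `e_i`, the ORBIT LAW `μ.map (g ↦ g • e_i)` IS `subLaw s` (averaging argument).

NOT CLAIMED: identification of `subLaw s` with a Hausdorff measure; `s = ∅`.
-/

namespace Summit.Ventures.LatticeQCDFlow.Exactness

open Matrix MeasureTheory WithLp Metric Complex ProbabilityTheory Measure Set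
open scoped ENNReal

variable {n : Type*} [Fintype n] [DecidableEq n]

/-! ## §1 The Gaussian law of a coordinate sub-sphere -/

section SubLaw

/-- The complex index of a real coordinate (`inl a ↦ a`, `inr a ↦ a`). -/
def idxOf : n ⊕ n → n := Sum.elim id id

/-- **Projection onto the coordinates in `s`** (zero elsewhere). -/
noncomputable def projE (s : Finset n) (x : E n) : E n :=
  toLp 2 (fun k => if idxOf k ∈ s then x k else 0)

/-- Coordinates of the projection. -/
theorem projE_apply (s : Finset n) (x : E n) (k : n ⊕ n) :
    projE s x k = if idxOf k ∈ s then x k else 0 := rfl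

/-- Complex coordinates of the projection. -/
theorem cplx_projE (s : Finset n) (x : E n) (a : n) :
    cplx (projE s x) a = if a ∈ s then cplx x a else 0 := by
  by_cases ha : a ∈ s
  · rw [if_pos ha]
    apply Complex.ext <;> simp [cplx, complexify, projE, idxOf, ha]
  · rw [if_neg ha]
    apply Complex.ext <;> simp [cplx, complexify, projE, idxOf, ha]

/-- The projection is supported in `s`. -/
theorem cplx_projE_of_not_mem (s : Finset n) (x : E n) {a : n} (ha : a ∉ s) :
    cplx (projE s x) a = 0 := by
  rw [cplx_projE, if_neg ha]

/-- The projection is continuous … -/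
theorem continuous_projE (s : Finset n) : Continuous (projE (n := n) s) := by
  refine (PiLp.continuous_toLp 2 _).comp (continuous_pi fun k => ?_)
  by_cases hk : idxOf k ∈ s
  · simp only [hk, if_true]; exact PiLp.continuous_apply 2 _ k
  · simp only [hk, if_false]; exact continuous_const

/-- … hence measurable. -/
theorem measurable_projE (s : Finset n) : Measurable (projE (n := n) s) := (continuous_projE s).measurable

/-- The projection commutes with real scalars. -/
theorem projE_smul (s : Finset n) (c : ℝ) (x : E n) : projE s (c • x) = c • projE s x := by
  ext k
  simp only [projE_apply, PiLp.smul_apply, smul_eq_mul]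
  split_ifs <;> simp

/-- On all coordinates the projection is the identity. -/
@[simp] theorem projE_univ (x : E n) : projE Finset.univ x = x := by
  ext k; simp [projE_apply]

variable [Nonempty n]

/-- **The Gaussian law of the sub-sphere of `s`**: the direction of a standard Gaussian vector of
`ℝ^{2N}` projected onto the coordinates in `s` — the uniform probability on the unit sphere of the
coordinate subspace `ℂ^s`, as a law on `S^{2N−1}`. -/
noncomputable def subLaw (s : Finset n) : Measure (S n) :=
  (stdGaussian (E n)).map (fun x => dirSphere (projE s x))

/-- The defining map is measurable. -/
theorem measurable_dirSphere_projE (s : Finset n) :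
    Measurable fun x : E n => dirSphere (projE s x) :=
  measurable_dirSphere.comp (measurable_projE s)

/-- It is a probability measure. -/
instance isProbabilityMeasure_subLaw (s : Finset n) : IsProbabilityMeasure (subLaw (n := n) s) :=
  Measure.isProbabilityMeasure_map (measurable_dirSphere_projE s).aemeasurable

/-- **On all coordinates it is the uniform probability on `S^{2N−1}`** (Muller, `StdGaussianRadial.lean`). -/
theorem subLaw_univ : subLaw (Finset.univ : Finset n) = uniformSphere (volume : Measure (E n)) := by
  rw [subLaw]
  simp only [projE_univ]
  exact stdGaussian_map_dirSphere (n ⊕ n)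

omit [Nonempty n] in
/-- The projection onto a nonempty coordinate set vanishes only on a Gaussian-null set. -/
theorem stdGaussian_projE_eq_zero {s : Finset n} (hs : s.Nonempty) :
    stdGaussian (E n) {x | projE s x = 0} = 0 := by
  haveI : NullSingletonClass (gaussianReal 0 1) := nullSingletonClass_gaussianReal one_ne_zero
  obtain ⟨a, ha⟩ := hs
  have hS : MeasurableSet {x : E n | projE s x = 0} := measurable_projE s (measurableSet_singleton 0)
  rw [← map_pi_eq_stdGaussian, Measure.map_apply (measurable_toLp 2 _) hS]
  refine measure_mono_null (fun f hf => ?_)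
    (Measure.pi_hyperplane (fun _ : n ⊕ n => gaussianReal 0 1) (Sum.inl a) 0)
  have h0 : projE s (toLp 2 f) = 0 := hf
  have h1 := congrArg (fun x : E n => x (Sum.inl a)) h0
  simpa [projE_apply, idxOf, ha] using h1

omit [Nonempty n] in
/-- The set of sphere points supported in `s` is measurable. -/
theorem measurableSet_supported (s : Finset n) :
    MeasurableSet {z : S n | ∀ a ∉ s, cplx (z : E n) a = 0} := by
  have h : {z : S n | ∀ a ∉ s, cplx (z : E n) a = 0} =
      ⋂ a ∈ (sᶜ : Finset n), {z : S n | cplx (z : E n) a = 0} := by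
    ext z; simp
  rw [h]
  refine MeasurableSet.biInter (Set.to_countable _) fun a _ => ?_
  exact (isClosed_eq (((continuous_apply a).comp continuous_cplx).comp continuous_subtype_val)
    continuous_const).measurableSet

/-- **The sub-sphere law is carried by the sub-sphere**: almost surely the complex coordinates
outside `s` vanish. -/
theorem ae_subLaw_supported {s : Finset n} (hs : s.Nonempty) :
    ∀ᵐ z : S n ∂(subLaw s), ∀ a ∉ s, cplx (z : E n) a = 0 := by
  rw [subLaw, ae_map_iff (measurable_dirSphere_projE s).aemeasurable (measurableSet_supported s)]
  filter_upwards [compl_mem_ae_iff.2 (stdGaussian_projE_eq_zero hs)] with x hx a ha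
  have hx' : projE s x ≠ 0 := hx
  rw [dirSphere_coe hx', cplx_smul, Pi.smul_apply, cplx_projE_of_not_mem s x ha, smul_zero]

end SubLaw

/-! ## §2 Invariance under the coordinate subgroup -/

section Invariance

variable [Nonempty n]

omit [DecidableEq n] in
/-- The direction map is equivariant under linear isometries (off the origin). -/
theorem coe_dirSphere_linearIsometryEquiv (f : E n ≃ₗᵢ[ℝ] E n) {x : E n} (hx : x ≠ 0) :
    (dirSphere (f x) : E n) = f (dirSphere x) := by
  have hfx : f x ≠ 0 := fun h => hx (f.map_eq_zero_iff.1 h)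
  rw [dirSphere_coe hfx, LinearIsometryEquiv.norm_map, dirSphere_coe hx, LinearIsometryEquiv.map_smul]

/-- Equivariance for the `SU(N)` action: `dir(g y) = g • dir(y)` for `y ≠ 0`. -/
theorem dirSphere_rotC (g : Matrix.specialUnitaryGroup n ℂ) {y : E n} (hy : y ≠ 0) :
    dirSphere (rotC (g : Matrix n n ℂ) (Matrix.specialUnitaryGroup_le_unitaryGroup g.2) y) =
      actSU g (dirSphere y) :=
  Subtype.ext (coe_dirSphere_linearIsometryEquiv _ hy)

omit [Nonempty n] in
/-- **An element of `coordSubgroup s` commutes with the projection onto the coordinates in `s`.** -/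
theorem rotC_projE {s : Finset n} {g : Matrix.specialUnitaryGroup n ℂ} (hg : g ∈ coordSubgroup s)
    (x : E n) :
    rotC (g : Matrix n n ℂ) (Matrix.specialUnitaryGroup_le_unitaryGroup g.2) (projE s x) =
      projE s (rotC (g : Matrix n n ℂ) (Matrix.specialUnitaryGroup_le_unitaryGroup g.2) x) := by
  have hmv : ∀ (v : n → ℂ) (a : n), ((g : Matrix n n ℂ) *ᵥ v) a = ∑ b, (g : Matrix n n ℂ) a b * v b :=
    fun v a => rfl
  apply cplx_injective
  rw [cplx_rotC]
  funext a
  rw [cplx_projE, cplx_rotC]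
  by_cases ha : a ∈ s
  · rw [if_pos ha, hmv, hmv]
    refine Finset.sum_congr rfl fun b _ => ?_
    rw [cplx_projE]
    by_cases hb : b ∈ s
    · rw [if_pos hb]
    · rw [if_neg hb, (hg b hb a).1, if_neg (fun h : a = b => hb (h ▸ ha)), zero_mul]; simp
  · rw [if_neg ha, mulVec_apply_of_not_mem hg ha, cplx_projE, if_neg ha]

omit [Nonempty n] in
/-- The standard Gaussian of `ℝ^{2N}` is invariant under the `SU(N)` action. -/
theorem stdGaussian_map_rotC (g : Matrix.specialUnitaryGroup n ℂ) :
    (stdGaussian (E n)).map (rotC (g : Matrix n n ℂ) (Matrix.specialUnitaryGroup_le_unitaryGroup g.2)) =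
      stdGaussian (E n) :=
  stdGaussian_map _

/-- **The sub-sphere law of `s` is invariant under `coordSubgroup s`.** -/
theorem subLaw_map_actSU {s : Finset n} (hs : s.Nonempty) {g : Matrix.specialUnitaryGroup n ℂ}
    (hg : g ∈ coordSubgroup s) : (subLaw s).map (actSU g) = subLaw s := by
  rw [subLaw, Measure.map_map (measurable_actSU_right g) (measurable_dirSphere_projE s)]
  have hae : (actSU g ∘ fun x => dirSphere (projE s x)) =ᵐ[stdGaussian (E n)]
      ((fun x => dirSphere (projE s x)) ∘
        rotC (g : Matrix n n ℂ) (Matrix.specialUnitaryGroup_le_unitaryGroup g.2)) := by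
    filter_upwards [compl_mem_ae_iff.2 (stdGaussian_projE_eq_zero hs)] with x hx
    have hx' : projE s x ≠ 0 := hx
    change actSU g (dirSphere (projE s x)) = dirSphere (projE s (rotC _ _ x))
    rw [← rotC_projE hg, dirSphere_rotC g hx']
  rw [Measure.map_congr hae, ← Measure.map_map (measurable_dirSphere_projE s)
    (rotC _ _).continuous.measurable, stdGaussian_map_rotC]

end Invariance

/-! ## §3 The orbit law of a right-invariant law carried by `coordSubgroup s` is the sub-sphere law -/

section OrbitLaw

variable [Nonempty n]

/-- **Orbit laws are sub-sphere laws.**  Let `μ` be a probability law on `SU(N)` carried by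
`coordSubgroup s` (`s` nonempty, `i ∈ s`) such that every point of the sub-sphere of `s` is
`t • e_i` for some `t ∈ coordSubgroup s` under which `μ` is right-invariant.  Then the law of
`g • e_i`, `g ∼ μ`, is `subLaw s`.  (Averaging, as in `SphereOrbitLaw.lean`: `ν(A) = ∫ ν(g⁻¹A) dμ =
∫∫ 1_A(g z) dν dμ = ∫ (μ.map orbMap)(A) dν`.)  Instances: Haar of `coordSubgroup s` (`|s| ≥ 2`,
transitivity `CoordinateTransitive.lean`); the image of Haar(SU(2)) in a pair subgroup. -/
theorem map_orbMap_eq_subLaw {s : Finset n} (hs : s.Nonempty) {i : n}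
    (μ : Measure (Matrix.specialUnitaryGroup n ℂ)) [IsProbabilityMeasure μ]
    (hμK : ∀ᵐ g ∂μ, g ∈ coordSubgroup s)
    (htrans : ∀ z : S n, (∀ a ∉ s, cplx (z : E n) a = 0) →
      ∃ t : Matrix.specialUnitaryGroup n ℂ, orbMap i t = z ∧ μ.map (fun g => g * t) = μ) :
    μ.map (orbMap i) = subLaw s := by
  set ν := subLaw (n := n) s with hν
  ext A hA
  have hF : Measurable fun p : Matrix.specialUnitaryGroup n ℂ × S n =>
      A.indicator (1 : S n → ℝ≥0∞) (actSU p.1 p.2) :=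
    (measurable_one.indicator hA).comp continuous_actSU.measurable
  -- inner integral: constant on the sub-sphere, equal to the orbit law
  have hinner : ∀ z : S n, (∀ a ∉ s, cplx (z : E n) a = 0) →
      ∫⁻ g, A.indicator (1 : S n → ℝ≥0∞) (actSU g z) ∂μ = μ.map (orbMap i) A := by
    intro z hz
    obtain ⟨t, rfl, ht⟩ := htrans z hz
    have hf : Measurable fun g : Matrix.specialUnitaryGroup n ℂ =>
        A.indicator (1 : S n → ℝ≥0∞) (orbMap i g) :=
      (measurable_one.indicator hA).comp (measurable_orbMap i)
    have h2 := lintegral_map hf (measurable_mul_const t) (μ := μ)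
    rw [ht] at h2
    calc ∫⁻ g, A.indicator (1 : S n → ℝ≥0∞) (actSU g (orbMap i t)) ∂μ
        = ∫⁻ g, A.indicator (1 : S n → ℝ≥0∞) (orbMap i (g * t)) ∂μ := by simp_rw [orbMap_mul]
      _ = ∫⁻ g, A.indicator (1 : S n → ℝ≥0∞) (orbMap i g) ∂μ := h2.symm
      _ = μ.map (orbMap i) A := by
          change ∫⁻ g, ((orbMap i) ⁻¹' A).indicator 1 g ∂μ = _
          rw [lintegral_indicator_one ((measurable_orbMap i) hA), Measure.map_apply (measurable_orbMap i) hA]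
  -- outer integral: invariance of `ν` under `μ`-almost every `g`
  have houter : ∀ᵐ g ∂μ, ∫⁻ z, A.indicator (1 : S n → ℝ≥0∞) (actSU g z) ∂ν = ν A := by
    filter_upwards [hμK] with g hg
    change ∫⁻ z, ((fun z => actSU g z) ⁻¹' A).indicator 1 z ∂ν = ν A
    rw [lintegral_indicator_one ((measurable_actSU_right g) hA),
      ← Measure.map_apply (measurable_actSU_right g) hA, hν, subLaw_map_actSU hs hg]
  symm
  calc ν A = ∫⁻ _g, ν A ∂μ := by rw [lintegral_const, measure_univ, mul_one]
    _ = ∫⁻ g, ∫⁻ z, A.indicator (1 : S n → ℝ≥0∞) (actSU g z) ∂ν ∂μ := (lintegral_congr_ae houter).symm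
    _ = ∫⁻ z, ∫⁻ g, A.indicator (1 : S n → ℝ≥0∞) (actSU g z) ∂μ ∂ν := lintegral_lintegral_swap hF.aemeasurable
    _ = ∫⁻ _z, μ.map (orbMap i) A ∂ν := by
        refine lintegral_congr_ae ?_
        filter_upwards [ae_subLaw_supported (n := n) hs] with z hz
        exact hinner z hz
    _ = μ.map (orbMap i) A := by rw [lintegral_const, measure_univ, mul_one]

end OrbitLaw

end Summit.Ventures.LatticeQCDFlow.Exactness
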